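import Mathlib
import Summits.Ventures.PercRepro2.HCov
import Summits.Ventures.PercRepro2.HCovSwap
import Summits.Ventures.PercRepro2.OddsLemma
import Summits.Ventures.PercRepro2.RV
import Summits.Ventures.PercRepro2.RVBridge
import Summits.Ventures.PercRepro2.HubBernstein
import Summits.Ventures.PercRepro2.K5Kernel
import Summits.Ventures.PercRepro2.K5Conn
import Summits.Ventures.PercRepro2.K5Kron
import Summits.Ventures.PercRepro2.K5Digits

/-!
# (ii) = (RV) IS A THEOREM ON `K₅` FOR EVERY WEIGHT VECTOR
(blind cell PercRepro2, typer-1 g9; the last bridge file of the `K₅` certificate)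

The cleared (ii) `J1RV.rvTableExpr p ends5 0 1 2 3 4` (= `CaseOne.iiExpr`, RVBridge.lean) is a cubic in the
eight masses `P(Q), P(Q,bH), P(T′), P(T′,bH), P(T′,oH), P(T′,oH,bH), D, D_o`; each mass is a Bernstein-1 form
`Hub.bform p (indR T)` of its event table `T` (`prob_eq_bform`, the tables of `K5Kernel.lean` are the events
by `K5Conn.lean`), so by the Bernstein regrouping `Hub.bform_mul_mul` the cubic is
`Σ_k bern p k · (cntPos k − cntNeg k)` (`rvTableExpr_eq_bern`), `cntPos − cntNeg` the signed triple counts of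
`K5Kron.lean`.  `K5Digits.cntNeg_le_cntPos` (from the kernel certificate `K5.cert_ii`) makes every
coefficient `≥ 0`, and `bern p k ≥ 0` on `[0,1]^10`:

* **`rvTable_K5`**: `J1RV.RVTable p ends5 0 1 2 3 4` for every admissible `p : Fin 10 → R`;
* **`rv_K5`**: `J1RV.RV …`; **`caseOneRV_K5`**: `CaseOne.RV p ends5 0 1 2 3 4` — the statement of record of row
  2′J1-RV — and `zSplitII_K5` (`CaseOne.ZSplitII`), for every weight vector on `K₅` with the five marks
  `(o, a₁, a₂, a₃, b) = (0, 1, 2, 3, 4)`.  Every simple graph on five vertices with five distinct marks is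
  `K₅` with `p_e = 0` on the missing edges, so this is (RV) on every 5-vertex instance, all weights
  (mine-1 g17's typed positivity, verified by the kernel).
-/

namespace Summit.Ventures.PercRepro2

open Hub

namespace K5

section Bernstein

variable {R : Type*} [Field R] [LinearOrder R] [IsStrictOrderedRing R]

/-- The `0/1` indicator of a table, as a function into `R`. -/
def indR (T : (Fin 10 → Bool) → Bool) : (Fin 10 → Bool) → R := fun ω => if T ω then 1 else 0

omit [LinearOrder R] [IsStrictOrderedRing R] in
/-- The probability of an event is the Bernstein-1 form of its table. -/
lemma prob_eq_bform (p : Fin 10 → R) (X : Set (Config (Fin 10))) (T : (Fin 10 → Bool) → Bool)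
    (hT : ∀ ω, T ω = true ↔ ω ∈ X) : prob p X = bform p (indR T) := by
  unfold prob bform indR
  refine Finset.sum_congr rfl fun ω _ => ?_
  by_cases h : ω ∈ X
  · rw [Set.indicator_of_mem h, if_pos ((hT ω).2 h), mul_one]
  · rw [Set.indicator_of_notMem h, if_neg (fun h' => h ((hT ω).1 h')), mul_zero]

omit [LinearOrder R] [IsStrictOrderedRing R] in
/-- A product of three `0/1` values is the cast of the product of the bits. -/
lemma indR_mul (T₁ T₂ T₃ : (Fin 10 → Bool) → Bool) (a b c : Fin 10 → Bool) :
    (indR T₁ a : R) * indR T₂ b * indR T₃ c = (((T₁ a).toNat * (T₂ b).toNat * (T₃ c).toNat : ℕ) : R) := by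
  unfold indR
  cases T₁ a <;> cases T₂ b <;> cases T₃ c <;> simp

omit [LinearOrder R] [IsStrictOrderedRing R] in
/-- The Bernstein coefficient of three tables is the cast of the triple count. -/
lemma coef3_eq_cnt3 (T₁ T₂ T₃ : (Fin 10 → Bool) → Bool) (k : Fin 10 → Fin 4) :
    coef3 (indR T₁) (indR T₂) (indR T₃) k = ((cnt3 T₁ T₂ T₃ k : ℕ) : R) := by
  unfold coef3 cnt3
  rw [Nat.cast_sum]
  exact Finset.sum_congr rfl fun t _ => indR_mul T₁ T₂ T₃ t.1 t.2.1 t.2.2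

omit [LinearOrder R] [IsStrictOrderedRing R] in
/-- `D_o` is the mass of `PD ∩ {o ∈ C₁ ∪ C₂}` (the two parts are disjoint on `Q`). -/
lemma Do_eq_prob (p : Fin 10 → R) :
    CovForm.Do p ends5 0 1 2 3 = prob p (PDEvent ends5 1 2 3 ∩ (connEvent ends5 1 0 ∪ connEvent ends5 2 0)) := by
  unfold CovForm.Do
  rw [Set.inter_union_distrib_left, prob_union_of_disjoint]
  rw [Set.disjoint_left]
  rintro ω ⟨hPD, h1⟩ ⟨_, h2⟩
  have hQ : ω ∈ (connEvent ends5 1 2)ᶜ := hPD.1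
  exact hQ (conn_trans h1 (conn_symm h2))

omit [LinearOrder R] [IsStrictOrderedRing R] in
/-- The eight masses as Bernstein-1 forms. -/
lemma masses (p : Fin 10 → R) :
    J1RV.pQ p ends5 1 2 = bform p (indR tQ) ∧
    J1RV.pQb p ends5 1 2 4 = bform p (indR tQB) ∧
    J1RV.pT1 p ends5 1 2 3 = bform p (indR tA) ∧
    J1RV.pT1b p ends5 1 2 3 4 = bform p (indR tAB) ∧
    J1RV.pT1o p ends5 0 1 2 3 = bform p (indR tAO) ∧
    J1RV.pT1ob p ends5 0 1 2 3 4 = bform p (indR tABO) ∧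
    prob p (PDEvent ends5 1 2 3) = bform p (indR tPD) ∧
    CovForm.Do p ends5 0 1 2 3 = bform p (indR tPDoU) := by
  refine ⟨prob_eq_bform p _ _ tQ_iff, prob_eq_bform p _ _ tQB_iff, prob_eq_bform p _ _ tA_iff,
    prob_eq_bform p _ _ tAB_iff, prob_eq_bform p _ _ tAO_iff, ?_, prob_eq_bform p _ _ tPD_iff, ?_⟩
  · unfold J1RV.pT1ob
    rw [show avoidAll ends5 2 {1} ∩ connEvent ends5 1 3 ∩ connEvent ends5 2 0 ∩ connEvent ends5 2 4 =
        avoidAll ends5 2 {1} ∩ connEvent ends5 1 3 ∩ connEvent ends5 2 4 ∩ connEvent ends5 2 0 from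
      Set.inter_right_comm _ _ _]
    exact prob_eq_bform p _ _ tABO_iff
  · rw [Do_eq_prob]
    exact prob_eq_bform p _ _ tPDoU_iff

omit [LinearOrder R] [IsStrictOrderedRing R] in
/-- The cleared (ii) as a combination of four products of three forms. -/
lemma rvTableExpr_eq_forms (p : Fin 10 → R) :
    J1RV.rvTableExpr p ends5 0 1 2 3 4 =
      bform p (indR tABO) * bform p (indR tQ) * bform p (indR tPD) +
        bform p (indR tQB) * bform p (indR tPDoU) * bform p (indR tA) -
        bform p (indR tQB) * bform p (indR tAO) * bform p (indR tPD) -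
        bform p (indR tAB) * bform p (indR tPDoU) * bform p (indR tQ) := by
  obtain ⟨h1, h2, h3, h4, h5, h6, h7, h8⟩ := masses p
  unfold J1RV.rvTableExpr
  rw [h1, h2, h3, h4, h5, h6, h7, h8]
  ring

omit [LinearOrder R] [IsStrictOrderedRing R] in
/-- **The cleared (ii) in the degree-3 Bernstein basis**: `Σ_k bern p k · (cntPos k − cntNeg k)`. -/
theorem rvTableExpr_eq_bern (p : Fin 10 → R) :
    J1RV.rvTableExpr p ends5 0 1 2 3 4 =
      ∑ k, bern p k * ((cntPos k : ℕ) - (cntNeg k : ℕ) : R) := by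
  rw [rvTableExpr_eq_forms, bform_mul_mul, bform_mul_mul, bform_mul_mul, bform_mul_mul,
    ← Finset.sum_add_distrib, ← Finset.sum_sub_distrib, ← Finset.sum_sub_distrib]
  refine Finset.sum_congr rfl fun k _ => ?_
  rw [coef3_eq_cnt3, coef3_eq_cnt3, coef3_eq_cnt3, coef3_eq_cnt3]
  unfold cntPos cntNeg
  push_cast
  ring

end Bernstein

section Theorem

variable {R : Type*} [Field R] [LinearOrder R] [IsStrictOrderedRing R]

/-- **(ii) = (RV) in table form on `K₅`, every weight vector.** -/
theorem rvTable_K5 (p : Fin 10 → R) (hp : IsProbVec p) : J1RV.RVTable p ends5 0 1 2 3 4 := by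
  unfold J1RV.RVTable
  rw [rvTableExpr_eq_bern]
  refine Finset.sum_nonneg fun k _ => mul_nonneg (bern_nonneg (fun i => ⟨hp.nonneg i, hp.le_one i⟩) k) ?_
  rw [sub_nonneg]
  exact_mod_cast cntNeg_le_cntPos k

/-- **(RV) on `K₅`, every weight vector** (`J1RV.RV`). -/
theorem rv_K5 (p : Fin 10 → R) (hp : IsProbVec p) : J1RV.RV p ends5 0 1 2 3 4 :=
  J1RV.rv_of_rvTable p hp ends5 0 1 2 3 4 (rvTable_K5 p hp)

/-- **THE STATEMENT OF RECORD OF ROW 2′J1-RV ON `K₅`**: `CaseOne.RV p ends5 0 1 2 3 4` for every admissible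
weight vector `p ∈ [0,1]^10` — hence for every graph on five vertices with five distinct marks. -/
theorem caseOneRV_K5 (p : Fin 10 → R) (hp : IsProbVec p) : CaseOne.RV p ends5 0 1 2 3 4 :=
  (J1RV.RV_iff p ends5 0 1 2 3 4).1 (rv_K5 p hp)

/-- (ii) of the Z-split on `K₅`, every weight vector (`CaseOne.ZSplitII`). -/
theorem zSplitII_K5 (p : Fin 10 → R) (hp : IsProbVec p) : CaseOne.ZSplitII p ends5 0 1 2 3 4 :=
  (J1RV.RVTable_iff p ends5 0 1 2 3 4).1 (rvTable_K5 p hp)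

end Theorem

end K5

end Summit.Ventures.PercRepro2
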